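import Literature.Analysis.Pluripotential.MongeAmpereAffine
import Mathlib.Analysis.Calculus.FDeriv.Measurable
import Mathlib.MeasureTheory.Constructions.BorelSpace.ContinuousLinearMap
import HarnessLib

/-!
# Measurability of Monge–Ampère densities; the regular mass as a supremum over compact sets

Topic `Literature/Analysis/Pluripotential`. Measure-theoretic bookkeeping for the proof of the named
fact `GuedjZeriahi2007_lelongNumber_eq_zero_of_regularMass_eq` (`NonPluripolarMongeAmpereMass.lean`):

* `measurable_fderiv_fderiv_apply`, `measurable_iteratedFDeriv_two_apply`,
  `measurable_leviMatrix_apply`, `measurable_det_leviMatrix`, **`measurable_heightDensity_self`** —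
  the top-degree Monge–Ampère density `heightDensity n g` of an ARBITRARY real function `g` on `ℂⁿ`
  is Borel measurable (Mathlib's `measurable_fderiv`: the derivative of any function is measurable);
* `exhaustion U m = closedBall 0 m ∩ {w | ∀ y ∉ U, dist w y ≥ 1/(m+1)}` — a monotone compact
  exhaustion of an open set of a proper normed group (`exhaustion_subset`, `isCompact_exhaustion`,
  `monotone_exhaustion`, `iUnion_exhaustion`);
* **`ClosedPositiveOneOneCurrent.regularMass_le_of_forall_isCompact`** — inner regularity:
  `regularMass N T ≤ B` as soon as `∫_K MA(g) ≤ B` for all compact `K ⊆ Reg(T)`;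
* `setLIntegral_heightDensity_fsPotential_ball_pos` — `μ_FS(B(0, R)) > 0` for `R > 0`.

Everything is proved; the only definition (`exhaustion`) has an explicit body. [folklore]
-/

noncomputable section

open scoped Topology ENNReal
open MeasureTheory Filter Set Metric Complex
open Literature.AlgebraicGeometry.HodgeTheory.BiextensionHeight (leviMatrix heightDensity
  fsPotential chartVec)

namespace Literature.Analysis.Pluripotential

variable {n : ℕ}

/-! ### Measurability of second derivatives, Levi matrices and Monge–Ampère densities -/

/-- Second derivatives `w ↦ D²g(w)(a, b)` of an ARBITRARY function are Borel measurable (the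
derivative of any function is measurable, `measurable_fderiv`, applied twice). [folklore] -/
theorem measurable_fderiv_fderiv_apply {E : Type*} [NormedAddCommGroup E] [NormedSpace ℝ E]
    [MeasurableSpace E] [BorelSpace E] [FiniteDimensional ℝ E] (g : E → ℝ) (a b : E) :
    Measurable fun w ↦ fderiv ℝ (fderiv ℝ g) w a b := by
  have h1 : Measurable (fderiv ℝ (fderiv ℝ g)) := measurable_fderiv ℝ (fderiv ℝ g)
  have h2 : Measurable fun φ : E →L[ℝ] E →L[ℝ] ℝ ↦ φ a := ContinuousLinearMap.measurable_apply a
  have h3 : Measurable fun ψ : E →L[ℝ] ℝ ↦ ψ b := ContinuousLinearMap.measurable_apply b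
  exact h3.comp (h2.comp h1)

/-- Entries of the second derivative `iteratedFDeriv ℝ 2 g w ![a, b]` are measurable. [folklore] -/
theorem measurable_iteratedFDeriv_two_apply (g : (Fin n → ℂ) → ℝ) (a b : Fin n → ℂ) :
    Measurable fun w ↦ iteratedFDeriv ℝ 2 g w ![a, b] := by
  have h : (fun w ↦ iteratedFDeriv ℝ 2 g w ![a, b]) = fun w ↦ fderiv ℝ (fderiv ℝ g) w a b := by
    funext w
    simp only [iteratedFDeriv_two_apply, Matrix.cons_val_zero, Matrix.cons_val_one]
  rw [h]
  exact measurable_fderiv_fderiv_apply g a b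

/-- Entries of the Levi matrix of an arbitrary real function are measurable. [folklore] -/
theorem measurable_leviMatrix_apply (g : (Fin n → ℂ) → ℝ) (p q : Fin n) :
    Measurable fun w ↦ leviMatrix g w p q := by
  unfold leviMatrix
  have hm := measurable_iteratedFDeriv_two_apply g
  refine Measurable.div_const (Measurable.add ?_ ?_) _
  · exact measurable_ofReal.comp ((hm _ _).add (hm _ _))
  · exact (measurable_ofReal.comp ((hm _ _).sub (hm _ _))).mul_const _

/-- The determinant of the Levi matrix is measurable. [folklore] -/
theorem measurable_det_leviMatrix (g : (Fin n → ℂ) → ℝ) :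
    Measurable fun w ↦ (leviMatrix g w).det := by
  simp_rw [Matrix.det_apply]
  refine Finset.measurable_fun_sum _ fun σ _ ↦ ?_
  exact (Finset.measurable_fun_prod _ fun i _ ↦ measurable_leviMatrix_apply g _ _).const_smul _

/-- **The top-degree Monge–Ampère density of an arbitrary real function is measurable.**
[folklore] -/
theorem measurable_heightDensity_self (g : (Fin n → ℂ) → ℝ) : Measurable (heightDensity n g) := by
  have h : heightDensity n g
      = fun w ↦ (n.factorial : ℝ) * (2 / Real.pi) ^ n * ((leviMatrix g w).det).re :=
    funext (heightDensity_self_eq g)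
  rw [h]
  exact (measurable_re.comp (measurable_det_leviMatrix g)).const_mul _

/-- The `[0, ∞]`-valued top-degree density is measurable. [folklore] -/
theorem measurable_ofReal_heightDensity_self (g : (Fin n → ℂ) → ℝ) :
    Measurable fun w ↦ ENNReal.ofReal (heightDensity n g w) :=
  (measurable_heightDensity_self g).ennreal_ofReal

/-! ### A compact exhaustion of an open set -/

section Exhaustion

variable {E : Type*} [NormedAddCommGroup E]

/-- The standard compact exhaustion `K_m = {‖w‖ ≤ m} ∩ {dist(w, Uᶜ) ≥ 1/(m+1)}` of an open set,
written without `infDist` (so that `U = univ` needs no special treatment). [folklore] -/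
def exhaustion (U : Set E) (m : ℕ) : Set E :=
  closedBall 0 m ∩ {w | ∀ y, y ∉ U → (1 : ℝ) / (m + 1) ≤ dist w y}

/-- `K_m ⊆ U`. [folklore] -/
theorem exhaustion_subset (U : Set E) (m : ℕ) : exhaustion U m ⊆ U := by
  intro w hw
  by_contra h
  have := hw.2 w h
  rw [dist_self] at this
  have : (0 : ℝ) < 1 / (m + 1) := by positivity
  linarith

/-- `K_m` is closed. [folklore] -/
theorem isClosed_exhaustion (U : Set E) (m : ℕ) : IsClosed (exhaustion U m) := by
  refine isClosed_closedBall.inter ?_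
  have h : {w : E | ∀ y, y ∉ U → (1 : ℝ) / (m + 1) ≤ dist w y}
      = ⋂ y ∈ Uᶜ, {w : E | (1 : ℝ) / (m + 1) ≤ dist w y} := by
    ext w; simp
  rw [h]
  exact isClosed_biInter fun y _ ↦ isClosed_le continuous_const (continuous_id.dist continuous_const)

/-- `K_m` is compact (proper space). [folklore] -/
theorem isCompact_exhaustion [ProperSpace E] (U : Set E) (m : ℕ) : IsCompact (exhaustion U m) :=
  IsCompact.of_isClosed_subset (isCompact_closedBall (0 : E) m) (isClosed_exhaustion U m)
    inter_subset_left

/-- `K_m` increases with `m`. [folklore] -/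
theorem monotone_exhaustion (U : Set E) : Monotone (exhaustion U) := by
  intro m m' hmm' w hw
  refine ⟨closedBall_subset_closedBall (by exact_mod_cast hmm') hw.1, fun y hy ↦ ?_⟩
  have h1 := hw.2 y hy
  have h2 : (1 : ℝ) / (m' + 1) ≤ 1 / (m + 1) := by
    gcongr
  linarith

/-- `⋃_m K_m = U` for `U` open. [folklore] -/
theorem iUnion_exhaustion {U : Set E} (hU : IsOpen U) : ⋃ m, exhaustion U m = U := by
  refine subset_antisymm (iUnion_subset fun m ↦ exhaustion_subset U m) fun w hw ↦ ?_
  obtain ⟨r, hr, hball⟩ := Metric.isOpen_iff.1 hU w hw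
  obtain ⟨m, hm⟩ := exists_nat_ge (max ‖w‖ (1 / r))
  refine mem_iUnion.2 ⟨m, ?_, fun y hy ↦ ?_⟩
  · rw [mem_closedBall, dist_zero_right]
    exact (le_max_left _ _).trans hm
  · have hyr : r ≤ dist w y := by
      by_contra h
      exact hy (hball (by rw [mem_ball, dist_comm]; linarith))
    have h1 : 1 / r ≤ m := (le_max_right _ _).trans hm
    have h2 : (1 : ℝ) / (m + 1) ≤ r := by
      rw [div_le_iff₀ (by positivity)]
      rw [div_le_iff₀ hr] at h1
      nlinarith
    linarith

end Exhaustion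

/-! ### The regular mass is a supremum over compact subsets of the regular locus -/

namespace ClosedPositiveOneOneCurrent

variable {N : ℕ} (T : ClosedPositiveOneOneCurrent N)

/-- **Inner regularity of the regular Monge–Ampère mass**: if `∫_K MA(g) ≤ B` for every compact
`K ⊆ Reg(T)`, then `regularMass N T ≤ B`. [folklore] -/
theorem regularMass_le_of_forall_isCompact (B : ℝ≥0∞)
    (h : ∀ K : Set (Fin N → ℂ), IsCompact K → K ⊆ T.regularLocus →
      ∫⁻ w in K, ENNReal.ofReal (heightDensity N T.chartPotential w) ≤ B) :
    T.regularMass N ≤ B := by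
  set f : (Fin N → ℂ) → ℝ≥0∞ := fun w ↦ ENNReal.ofReal (heightDensity N T.chartPotential w) with hf
  have hfm : Measurable f := measurable_ofReal_heightDensity_self _
  set μ : Measure (Fin N → ℂ) := volume.withDensity f with hμ
  have hK : ∀ m, μ (exhaustion T.regularLocus m) ≤ B := fun m ↦ by
    rw [hμ, withDensity_apply _ (isClosed_exhaustion _ m).measurableSet]
    exact h _ (isCompact_exhaustion _ m) (exhaustion_subset _ m)
  have hlim := tendsto_measure_iUnion_atTop (μ := μ) (monotone_exhaustion T.regularLocus)
  rw [iUnion_exhaustion T.isOpen_regularLocus] at hlim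
  have hle : μ T.regularLocus ≤ B := le_of_tendsto' hlim hK
  rwa [hμ, withDensity_apply _ T.measurableSet_regularLocus] at hle

end ClosedPositiveOneOneCurrent

/-! ### The Fubini–Study mass of a ball is positive -/

/-- **`μ_FS(B(0, R)) > 0`** for `R > 0`: the Fubini–Study density is bounded below on the ball by
`N!/(πᴺ (1 + N R²)^{N+1}) > 0`. [folklore] -/
theorem setLIntegral_heightDensity_fsPotential_ball_pos {N : ℕ} {R : ℝ} (hR : 0 < R) :
    0 < ∫⁻ w in ball (0 : Fin N → ℂ) R, ENNReal.ofReal (heightDensity N fsPotential w) := by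
  set d₀ : ℝ := (N.factorial : ℝ) / (Real.pi ^ N * (1 + N * R ^ 2) ^ (N + 1)) with hd₀
  have hd₀pos : 0 < d₀ := by positivity
  have hle : ∀ w ∈ ball (0 : Fin N → ℂ) R, ENNReal.ofReal d₀
      ≤ ENNReal.ofReal (heightDensity N fsPotential w) := by
    intro w hw
    refine ENNReal.ofReal_le_ofReal ?_
    rw [heightDensity_fsPotential, hd₀]
    have hw' : ‖w‖ ≤ R := by
      rw [mem_ball, dist_zero_right] at hw
      exact hw.le
    have h1 : ∑ r, ‖w r‖ ^ 2 ≤ N * R ^ 2 := by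
      have h := Finset.sum_le_card_nsmul Finset.univ (fun p ↦ ‖w p‖ ^ 2) (R ^ 2)
        fun p _ ↦ by
          have := norm_le_pi_norm w p
          exact pow_le_pow_left₀ (norm_nonneg _) (this.trans hw') 2
      simpa using h
    have hpos := one_add_sum_norm_sq_pos w
    gcongr
  have hball : 0 < volume (ball (0 : Fin N → ℂ) R) := measure_ball_pos volume 0 hR
  calc (0 : ℝ≥0∞) < ENNReal.ofReal d₀ * volume (ball (0 : Fin N → ℂ) R) :=
        ENNReal.mul_pos (ENNReal.ofReal_pos.2 hd₀pos).ne' hball.ne'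
    _ = ∫⁻ _ in ball (0 : Fin N → ℂ) R, ENNReal.ofReal d₀ := (setLIntegral_const _ _).symm
    _ ≤ ∫⁻ w in ball (0 : Fin N → ℂ) R, ENNReal.ofReal (heightDensity N fsPotential w) :=
        setLIntegral_mono measurable_ofReal_heightDensity_fsPotential hle

end Literature.Analysis.Pluripotential

end
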